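import Summits.AtomisticToContinuum.HydrodynamicLimit.Theorems.RelayRaceLocalityLightConeInLawSketchLine
import Literature.MathematicalPhysics.KineticTheory.HardSphereEulerProofs
import HarnessLib

/-!
# Crux `LightConeInLaw` (stmt-AtomisticToContinuum-12500), line `Sketch` — stub `stub_profileId`

Registered stub of the lead prover's skeleton `Cruxes/LightConeInLaw/Lines/Sketch.lean` (route
`RelayRaceLocality`): the statics step for gas 2 of the crux. Under the canonical local Gibbs
laws `particleLaw (Φ N) (canonicalDensity G3 (ε N) (n N) (localGibbsProfile a u θ))` of `n N → ∞`
hard spheres of arbitrary diameters `ε N` on `𝕋³` (probability measures), a law of large numbers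
at time `0` towards Euler data `(ρ₀, U₀, Θ₀)` with `ρ₀ > 0` forces `U₀ = u` and `Θ₀ = θ`.

The `(N + 1, hsDiameter σ N)` lemmas of `HardSphereEulerProofs` are redone for general `(ε, n)`:
`Φ_0 = id` in law (`particleLaw_preimage_flow_zero`), the disintegration into positions and
independent Gaussian velocities (`lintegral_particleLaw_canonical`, from
`lintegral_gibbsWeight_mul`), the conditional Bienaymé–Chebyshev bound
`P {δ ≤ |n⁻¹ ∑ᵢ χ(xᵢ) Y(xᵢ, vᵢ)|} ≤ C² B / (n δ²) → 0` (`particleLaw_velFluct_le`,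
`tendsto_particleLaw_velFluct`). Two elementary lemmas close the identification: limits in
probability under probability measures are unique (`eq_of_tendsto_measure_lt_abs_sub`), and two
continuous functions on `𝕋³` with equal integrals against every continuous `χ` coincide
(`eq_of_forall_integral_mul_eq`; Haar measure charges open sets). No definitions, no named facts.
-/

namespace Summit.AtomisticToContinuum.HydrodynamicLimit.Theorems.LightConeInLawSketch.ProfileId

open scoped BigOperators Topology Classical ENNReal
open Filter Set MeasureTheory ProbabilityTheory
open Literature.MathematicalPhysics.KineticTheory Literature.Analysis.FluidPDE

noncomputable section

variable {a θ : T3 → ℝ} {u : T3 → V3}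

/-- **Events transported by `Φ_0` have the same probability** under any law
`particleLaw Φ W` (= `W` times the Liouville measure of `D_ε^n`): `Φ_0 = id` on the good set,
which is conull for the Liouville measure, and the law is absolutely continuous with respect
to it (general-`(ε, n)` form of `localGibbsLaw_preimage_flow_zero`). -/
theorem particleLaw_preimage_flow_zero {ε : ℝ} {n : ℕ} (Φ : HardSphereFlow G3 ε n)
    (W : Config n (Fin 3) T3 → ℝ) (A : Set (Config n (Fin 3) T3)) :
    particleLaw Φ W ((Φ.flow 0) ⁻¹' A) = particleLaw Φ W A := by
  refine measure_congr ?_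
  have hac : particleLaw Φ W ≪ liouville G3 n ε := by
    rw [particleLaw_eq]
    exact withDensity_absolutelyContinuous _ _
  filter_upwards [hac.ae_le Φ.ae_mem_good] with z hz
  simp only [eq_iff_iff]
  show Φ.flow 0 z ∈ A ↔ z ∈ A
  rw [Φ.flow_zero z hz]

/-- **Disintegration of the canonical local Gibbs law** of `n` spheres of diameter `ε` into
positions and velocities: for measurable `G ≥ 0`,
`∫ G dP = ∫ dx Z⁻¹ 𝟙_{no overlap}(x) ∏ a(xᵢ) ∫ G(x, v) ⊗ᵢ N(u(xᵢ), θ(xᵢ))(dv)` — the law is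
the canonical density times Lebesgue measure (`particleLaw_eq_withDensity`, the density
vanishes off `D_ε^n`), then `lintegral_gibbsWeight_mul`. -/
theorem lintegral_particleLaw_canonical (ha : Continuous a) (hθ : Continuous θ)
    (hu : Continuous u) (ha0 : ∀ x, 0 ≤ a x) (hθ0 : ∀ x, 0 < θ x) {ε : ℝ} {n : ℕ}
    (Φ : HardSphereFlow G3 ε n) {G : Config n (Fin 3) T3 → ℝ≥0∞} (hG : Measurable G) :
    ∫⁻ z, G z ∂particleLaw Φ (canonicalDensity G3 ε n (localGibbsProfile a u θ)) =
      ∫⁻ x, ENNReal.ofReal ((canonicalPartition G3 ε n (localGibbsProfile a u θ))⁻¹ *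
          posWeight a ε n x) * ∫⁻ v, G (zipConfig (x, v)) ∂velMeasure u θ x := by
  set Z := canonicalPartition G3 ε n (localGibbsProfile a u θ) with hZ
  have hZ0 : 0 ≤ Z⁻¹ :=
    inv_nonneg.2 (canonicalPartition_nonneg _ _ _
      (localGibbsProfile_nonneg ha0 fun x => (hθ0 x).le))
  have hDm : Measurable fun z =>
      ENNReal.ofReal (canonicalDensity G3 ε n (localGibbsProfile a u θ) z) :=
    (measurable_canonicalDensity ε n (measurable_localGibbsProfile ha hθ hu)).ennreal_ofReal
  calc ∫⁻ z, G z ∂particleLaw Φ (canonicalDensity G3 ε n (localGibbsProfile a u θ))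
      = ∫⁻ z, ENNReal.ofReal (canonicalDensity G3 ε n (localGibbsProfile a u θ) z) * G z := by
        rw [particleLaw_eq_withDensity Φ fun _ hz => canonicalDensity_eq_zero_of_notMem _ _ _ _ hz,
          lintegral_withDensity_eq_lintegral_mul _ hDm hG]
        rfl
    _ = ENNReal.ofReal Z⁻¹ * ∫⁻ z, ENNReal.ofReal ((hardSphereDomain G3 n ε).indicator
          (tensorPow n (localGibbsProfile a u θ)) z) * G z := by
        rw [← lintegral_const_mul' _ _ ENNReal.ofReal_ne_top]
        refine lintegral_congr fun z => ?_
        rw [canonicalDensity, ENNReal.ofReal_mul hZ0, mul_assoc]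
    _ = ENNReal.ofReal Z⁻¹ * ∫⁻ x, ENNReal.ofReal (posWeight a ε n x) *
          ∫⁻ v, G (zipConfig (x, v)) ∂velMeasure u θ x := by
        rw [lintegral_gibbsWeight_mul ha hθ hu ha0 hθ0 ε n hG]
    _ = _ := by
        rw [← lintegral_const_mul' _ _ ENNReal.ofReal_ne_top]
        refine lintegral_congr fun x => ?_
        rw [ENNReal.ofReal_mul hZ0, mul_assoc]

/-- **Velocity fluctuations are small** (general-`(ε, n)` form of
`localGibbsMeasure_velFluct_le`). For a jointly measurable family of per-particle velocity
observables `Y x : ℝ³ → ℝ` which, under `N(u(x), θ(x))`, are centred, square integrable with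
variance `≤ B`, and a continuous `χ` with `|χ| ≤ C`: the canonical probability (a probability
law) that `|n⁻¹ ∑ᵢ χ(xᵢ) Y(xᵢ, vᵢ)| ≥ δ` is at most `C² B / (n δ²)` — conditionally on the
positions the velocities are independent Gaussians; Bienaymé–Chebyshev
(`pi_measure_avg_ge_le`); the position marginal has mass `1`. -/
theorem particleLaw_velFluct_le (ha : Continuous a) (hθ : Continuous θ) (hu : Continuous u)
    (ha0 : ∀ x, 0 ≤ a x) (hθ0 : ∀ x, 0 < θ x) {ε : ℝ} {n : ℕ} (hn : 0 < n)
    (Φ : HardSphereFlow G3 ε n)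
    [IsProbabilityMeasure (particleLaw Φ (canonicalDensity G3 ε n (localGibbsProfile a u θ)))]
    {Y : T3 → V3 → ℝ} (hYm : Measurable fun p : T3 × V3 => Y p.1 p.2)
    (hY2 : ∀ x, MemLp (Y x) 2 (gaussMeasure (u x) (θ x)))
    (hY0 : ∀ x, ∫ v, Y x v ∂gaussMeasure (u x) (θ x) = 0)
    {B : ℝ} (hYB : ∀ x, Var[Y x; gaussMeasure (u x) (θ x)] ≤ B)
    {χ : T3 → ℝ} (hχ : Continuous χ) {C : ℝ} (hC : ∀ x, |χ x| ≤ C) {δ : ℝ} (hδ : 0 < δ) :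
    particleLaw Φ (canonicalDensity G3 ε n (localGibbsProfile a u θ))
        {z | δ ≤ |(n : ℝ)⁻¹ * ∑ i, χ (z i).1 * Y (z i).1 (z i).2|} ≤
      ENNReal.ofReal (C ^ 2 * B / (n * δ ^ 2)) := by
  haveI : Nonempty (Fin n) := ⟨⟨0, hn⟩⟩
  set A := {z : Config n (Fin 3) T3 | δ ≤ |(n : ℝ)⁻¹ * ∑ i, χ (z i).1 * Y (z i).1 (z i).2|}
    with hA
  have hFm : Measurable fun z : Config n (Fin 3) T3 =>
      (n : ℝ)⁻¹ * ∑ i, χ (z i).1 * Y (z i).1 (z i).2 := by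
    refine measurable_const.mul (Finset.measurable_sum _ fun i _ => ?_)
    exact (hχ.measurable.comp (measurable_pi_apply i).fst).mul
      (hYm.comp (measurable_pi_apply i))
  have hAm : MeasurableSet A := measurableSet_le measurable_const hFm.abs
  -- conditional (velocity) bound, uniformly in the positions
  have hvel : ∀ x : Fin n → T3,
      velMeasure u θ x {v | zipConfig (x, v) ∈ A} ≤
        ENNReal.ofReal (C ^ 2 * B / (n * δ ^ 2)) := by
    intro x
    have h := pi_measure_avg_ge_le (fun i => gaussMeasure (u (x i)) (θ (x i)))
      (fun i w => χ (x i) * Y (x i) w) (fun i => (hY2 (x i)).const_mul _)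
      (fun i => by rw [integral_const_mul, hY0, mul_zero])
      (B := C ^ 2 * B) (fun i => ?_) hδ
    · simpa [velMeasure, hA, Fintype.card_fin] using h
    · rw [variance_const_mul]
      have hB0 : 0 ≤ B := (variance_nonneg _ _).trans (hYB (x i))
      exact mul_le_mul (by simpa using pow_le_pow_left₀ (abs_nonneg _) (hC (x i)) 2)
        (hYB (x i)) (variance_nonneg _ _) (sq_nonneg _)
  -- normalisation of the position marginal
  have h1 := lintegral_particleLaw_canonical ha hθ hu ha0 hθ0 Φ (G := fun _ => 1)
    measurable_const
  simp only [lintegral_const, measure_univ, mul_one] at h1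
  calc particleLaw Φ (canonicalDensity G3 ε n (localGibbsProfile a u θ)) A
      = ∫⁻ z, A.indicator 1 z ∂particleLaw Φ (canonicalDensity G3 ε n (localGibbsProfile a u θ)) :=
        (lintegral_indicator_one hAm).symm
    _ = ∫⁻ x, ENNReal.ofReal ((canonicalPartition G3 ε n (localGibbsProfile a u θ))⁻¹ *
          posWeight a ε n x) * velMeasure u θ x {v | zipConfig (x, v) ∈ A} := by
        rw [lintegral_particleLaw_canonical ha hθ hu ha0 hθ0 Φ (measurable_one.indicator hAm)]
        refine lintegral_congr fun x => ?_
        congr 1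
        have hpre : MeasurableSet {v : Fin n → V3 | zipConfig (x, v) ∈ A} :=
          hAm.preimage (measurable_zipConfig.comp (measurable_const.prodMk measurable_id))
        rw [← lintegral_indicator_one hpre]
        rfl
    _ ≤ ∫⁻ x, ENNReal.ofReal ((canonicalPartition G3 ε n (localGibbsProfile a u θ))⁻¹ *
          posWeight a ε n x) * ENNReal.ofReal (C ^ 2 * B / (n * δ ^ 2)) :=
        lintegral_mono fun x => mul_le_mul_right (hvel x) _
    _ = ENNReal.ofReal (C ^ 2 * B / (n * δ ^ 2)) := by
        have hρm : Measurable fun x : Fin n → T3 => ENNReal.ofReal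
            ((canonicalPartition G3 ε n (localGibbsProfile a u θ))⁻¹ * posWeight a ε n x) :=
          (measurable_const.mul (measurable_posWeight ha _ _)).ennreal_ofReal
        rw [lintegral_mul_const _ hρm, ← h1, one_mul]

/-- **Velocity fluctuations tend to zero in probability** along any canonical local Gibbs family
of `n N → ∞` spheres (probability laws): the rate `C² B / (n N · η²)` of
`particleLaw_velFluct_le` tends to `0`; the finitely many `N` with `n N = 0` are irrelevant. -/
theorem tendsto_particleLaw_velFluct (ha : Continuous a) (hθ : Continuous θ) (hu : Continuous u)
    (ha0 : ∀ x, 0 ≤ a x) (hθ0 : ∀ x, 0 < θ x) (n : ℕ → ℕ) (ε : ℕ → ℝ)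
    (hn : Tendsto n atTop atTop) (Φ : (N : ℕ) → HardSphereFlow G3 (ε N) (n N))
    (hP : ∀ N, IsProbabilityMeasure
      (particleLaw (Φ N) (canonicalDensity G3 (ε N) (n N) (localGibbsProfile a u θ))))
    {Y : T3 → V3 → ℝ} (hYm : Measurable fun p : T3 × V3 => Y p.1 p.2)
    (hY2 : ∀ x, MemLp (Y x) 2 (gaussMeasure (u x) (θ x)))
    (hY0 : ∀ x, ∫ v, Y x v ∂gaussMeasure (u x) (θ x) = 0)
    {B : ℝ} (hYB : ∀ x, Var[Y x; gaussMeasure (u x) (θ x)] ≤ B)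
    {χ : T3 → ℝ} (hχ : Continuous χ) {η : ℝ} (hη : 0 < η) :
    Tendsto (fun N => particleLaw (Φ N) (canonicalDensity G3 (ε N) (n N) (localGibbsProfile a u θ))
      {z | η ≤ |((n N : ℕ) : ℝ)⁻¹ * ∑ i, χ (z i).1 * Y (z i).1 (z i).2|}) atTop (𝓝 0) := by
  obtain ⟨C, -, hC⟩ := exists_forall_abs_le_of_continuous hχ
  have hrate : Tendsto (fun N => ENNReal.ofReal (C ^ 2 * B / ((n N : ℝ) * η ^ 2))) atTop (𝓝 0) := by
    have h1 : Tendsto (fun N => (n N : ℝ) * η ^ 2) atTop atTop :=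
      Tendsto.atTop_mul_const (pow_pos hη 2) (tendsto_natCast_atTop_atTop.comp hn)
    have h2 : Tendsto (fun N => C ^ 2 * B / ((n N : ℝ) * η ^ 2)) atTop (𝓝 0) :=
      tendsto_const_nhds.div_atTop h1
    have h3 := ENNReal.tendsto_ofReal h2
    rwa [ENNReal.ofReal_zero] at h3
  refine tendsto_of_tendsto_of_tendsto_of_le_of_le' tendsto_const_nhds hrate
    (Eventually.of_forall fun _ => zero_le) ?_
  filter_upwards [hn.eventually_gt_atTop 0] with N hN
  haveI := hP N
  exact particleLaw_velFluct_le ha hθ hu ha0 hθ0 hN (Φ N) hYm hY2 hY0 hYB hχ hC hη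

/-- **Limits in probability are unique.** If real random variables `X N` under probability
measures `P N` converge in probability both to `c₁` and to `c₂`, then `c₁ = c₂`: otherwise with
`δ = |c₁ - c₂| / 3` the two deviation events cover the whole space, whose mass is `1`. -/
theorem eq_of_tendsto_measure_lt_abs_sub {Ω : ℕ → Type*} [∀ N, MeasurableSpace (Ω N)]
    (P : (N : ℕ) → Measure (Ω N)) [∀ N, IsProbabilityMeasure (P N)] (X : (N : ℕ) → Ω N → ℝ)
    {c₁ c₂ : ℝ}
    (h₁ : ∀ δ : ℝ, 0 < δ → Tendsto (fun N => P N {z | δ < |X N z - c₁|}) atTop (𝓝 0))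
    (h₂ : ∀ δ : ℝ, 0 < δ → Tendsto (fun N => P N {z | δ < |X N z - c₂|}) atTop (𝓝 0)) :
    c₁ = c₂ := by
  by_contra hne
  have hδ : 0 < |c₁ - c₂| / 3 := div_pos (abs_pos.2 (sub_ne_zero.2 hne)) (by norm_num)
  have hcover : ∀ N, (Set.univ : Set (Ω N)) ⊆
      {z | |c₁ - c₂| / 3 < |X N z - c₁|} ∪ {z | |c₁ - c₂| / 3 < |X N z - c₂|} := by
    intro N z _
    by_contra hz
    simp only [Set.mem_union, Set.mem_setOf_eq, not_or, not_lt] at hz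
    have h := abs_sub_le c₁ (X N z) c₂
    rw [abs_sub_comm c₁ (X N z)] at h
    linarith [hz.1, hz.2, abs_nonneg (c₁ - c₂)]
  have hge : ∀ N, (1 : ℝ≥0∞) ≤
      P N {z | |c₁ - c₂| / 3 < |X N z - c₁|} + P N {z | |c₁ - c₂| / 3 < |X N z - c₂|} :=
    fun N => (measure_univ (μ := P N)).symm.le.trans
      ((measure_mono (hcover N)).trans (measure_union_le _ _))
  have hlim := (h₁ _ hδ).add (h₂ _ hδ)
  rw [add_zero] at hlim
  exact absurd (ge_of_tendsto' hlim hge) (by simp)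

/-- Two continuous functions `f₁, f₂` on `𝕋³` with `∫ χ f₁ = ∫ χ f₂` for every continuous `χ`
coincide: with `g = f₁ - f₂` and `χ := g`, `∫ g² = 0`, so `g² = 0` a.e.
(`integral_eq_zero_iff_of_nonneg`), hence everywhere by continuity, the Haar measure of `𝕋³`
charging open sets. -/
theorem eq_of_forall_integral_mul_eq {f₁ f₂ : T3 → ℝ} (hf₁ : Continuous f₁)
    (hf₂ : Continuous f₂)
    (h : ∀ χ : T3 → ℝ, Continuous χ → ∫ x, χ x * f₁ x = ∫ x, χ x * f₂ x) (x : T3) :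
    f₁ x = f₂ x := by
  haveI : (volume : Measure T3).IsOpenPosMeasure := by
    rw [volume_pi]
    infer_instance
  have hg : Continuous fun y => f₁ y - f₂ y := hf₁.sub hf₂
  have h0 : ∫ y, (f₁ y - f₂ y) * (f₁ y - f₂ y) = 0 := by
    have hi : ∀ {f : T3 → ℝ}, Continuous f → Integrable fun y => (f₁ y - f₂ y) * f y :=
      fun hf => integrable_of_continuous_T3 (hg.mul hf)
    rw [show (fun y => (f₁ y - f₂ y) * (f₁ y - f₂ y)) =
        fun y => (f₁ y - f₂ y) * f₁ y - (f₁ y - f₂ y) * f₂ y from funext fun y => by ring,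
      integral_sub (hi hf₁) (hi hf₂), h _ hg, sub_self]
  have hae : (fun y => (f₁ y - f₂ y) * (f₁ y - f₂ y)) =ᵐ[volume] 0 :=
    (integral_eq_zero_iff_of_nonneg (fun y => mul_self_nonneg (f₁ y - f₂ y))
      (integrable_of_continuous_T3 (hg.mul hg))).1 h0
  have heq : (fun y => (f₁ y - f₂ y) * (f₁ y - f₂ y)) = 0 :=
    (Continuous.ae_eq_iff_eq volume (hg.mul hg) continuous_const).1 hae
  exact sub_eq_zero.1 (mul_self_eq_zero.1 (congrFun heq x))

/-- **Profile identification for general canonical local Gibbs families** (registered stub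
`stub_profileId` of the line `Sketch`, crux `LightConeInLaw`). Conditionally on the positions
the velocities are independent Gaussians `N(u(xᵢ), θ(xᵢ))`, so the velocity and kinetic-energy
fluctuations `(n N)⁻¹ ∑ χ(xᵢ)(vᵢ - u(xᵢ))`, `(n N)⁻¹ ∑ χ(xᵢ)(|vᵢ|²/2 - |u(xᵢ)|²/2 - 3θ(xᵢ)/2)`
tend to `0` in probability (`tendsto_particleLaw_velFluct`); with the density law of large
numbers tested against `χ uₗ` and `χ (|u|²/2 + 3θ/2)` this identifies the in-probability limits
of the momentum and energy fields a second time, so (`eq_of_tendsto_measure_lt_abs_sub`)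
`∫ χ ρ₀ U₀ₗ = ∫ χ uₗ ρ₀` and `∫ χ ρ₀ (|U₀|²/2 + 3Θ₀/2) = ∫ χ (|u|²/2 + 3θ/2) ρ₀` for every
continuous `χ`; by `eq_of_forall_integral_mul_eq` and `ρ₀ > 0`, `U₀ = u` and then `Θ₀ = θ`. -/
theorem stub_profileId :
    ∀ (a θ : T3 → ℝ) (u : T3 → V3), Continuous a → Continuous θ → Continuous u →
      (∀ x, 0 < a x) → (∀ x, 0 < θ x) →
    ∀ (n : ℕ → ℕ) (ε : ℕ → ℝ), Tendsto n atTop atTop →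
    ∀ Φ : (N : ℕ) → HardSphereFlow G3 (ε N) (n N),
      (∀ N, IsProbabilityMeasure
        (particleLaw (Φ N) (canonicalDensity G3 (ε N) (n N) (localGibbsProfile a u θ)))) →
    ∀ (ρ₀ Θ₀ : T3 → ℝ) (U₀ : T3 → V3), Continuous ρ₀ → Continuous U₀ → Continuous Θ₀ →
      (∀ x, 0 < ρ₀ x) →
      LLNAt n (fun N => particleLaw (Φ N)
        (canonicalDensity G3 (ε N) (n N) (localGibbsProfile a u θ))) Φ ρ₀ U₀ Θ₀ 0 →
      ∀ x, U₀ x = u x ∧ Θ₀ x = θ x := by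
  intro a θ u ha hθ hu ha0 hθ0 n ε hn Φ hP ρ₀ Θ₀ U₀ hρc hUc hΘc hρ0 hL
  have ha0' : ∀ x, 0 ≤ a x := fun x => (ha0 x).le
  haveI := hP
  /- (1) density-type events without the flow, for a general continuous weight `g` -/
  have hdens : ∀ g : T3 → ℝ, Continuous g → ∀ η : ℝ, 0 < η →
      Tendsto (fun N => particleLaw (Φ N) (canonicalDensity G3 (ε N) (n N)
        (localGibbsProfile a u θ))
        {z | η < |((n N : ℕ) : ℝ)⁻¹ * ∑ i, g (z i).1 - ∫ y, g y * ρ₀ y|}) atTop (𝓝 0) := by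
    intro g hg η hη
    refine ((hL g hg η hη).1).congr fun N => ?_
    calc particleLaw (Φ N) (canonicalDensity G3 (ε N) (n N) (localGibbsProfile a u θ))
          ((Φ N).flow 0 ⁻¹' {w | η < |empiricalDensityField w g - ∫ y, g y * ρ₀ y|})
        = particleLaw (Φ N) (canonicalDensity G3 (ε N) (n N) (localGibbsProfile a u θ))
          {w | η < |empiricalDensityField w g - ∫ y, g y * ρ₀ y|} :=
          particleLaw_preimage_flow_zero _ _ _
      _ = _ := by simp only [empiricalDensityField_eq_sum]
  /- (2) momentum: for every continuous `χ` and coordinate `l`, `∫ χ ρ₀ U₀ₗ = ∫ χ uₗ ρ₀` -/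
  have hmom : ∀ χ : T3 → ℝ, Continuous χ → ∀ l : Fin 3,
      ∫ x, χ x * ρ₀ x * U₀ x l = ∫ x, χ x * u x l * ρ₀ x := by
    intro χ hχ l
    set I : V3 := ∫ x, (χ x * ρ₀ x) • U₀ x with hI
    have hIl : I l = ∫ x, χ x * ρ₀ x * U₀ x l := by
      have hint : Integrable (fun x => (χ x * ρ₀ x) • U₀ x) :=
        integrable_of_continuous_T3 ((hχ.mul hρc).smul hUc)
      rw [hI, show (∫ x, (χ x * ρ₀ x) • U₀ x) l =
          (EuclideanSpace.proj l : V3 →L[ℝ] ℝ) (∫ x, (χ x * ρ₀ x) • U₀ x) from rfl,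
        ← ContinuousLinearMap.integral_comp_comm _ hint]
      refine integral_congr_ae (Eventually.of_forall fun x => ?_)
      simp only [EuclideanSpace.coe_proj, PiLp.smul_apply, smul_eq_mul]
    rw [← hIl]
    refine eq_of_tendsto_measure_lt_abs_sub
      (fun N => particleLaw (Φ N) (canonicalDensity G3 (ε N) (n N) (localGibbsProfile a u θ)))
      (fun N z => empiricalMomentumField z χ l) (fun δ hδ => ?_) (fun δ hδ => ?_)
    · -- the limit `∫ χ ρ₀ U₀ₗ` from the momentum law of large numbers (coordinate `l`)
      refine tendsto_of_tendsto_of_tendsto_of_le_of_le tendsto_const_nhds (hL χ hχ δ hδ).2.1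
        (fun _ => zero_le) (fun N => ?_)
      calc particleLaw (Φ N) (canonicalDensity G3 (ε N) (n N) (localGibbsProfile a u θ))
            {z | δ < |empiricalMomentumField z χ l - I l|}
          ≤ particleLaw (Φ N) (canonicalDensity G3 (ε N) (n N) (localGibbsProfile a u θ))
            {z | δ < ‖empiricalMomentumField z χ - I‖} := by
            refine measure_mono fun z hz => ?_
            simp only [Set.mem_setOf_eq] at hz ⊢
            rw [← PiLp.sub_apply] at hz
            exact hz.trans_le (by simpa using PiLp.norm_apply_le (empiricalMomentumField z χ - I) l)
        _ = particleLaw (Φ N) (canonicalDensity G3 (ε N) (n N) (localGibbsProfile a u θ))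
            ((Φ N).flow 0 ⁻¹' {z | δ < ‖empiricalMomentumField z χ - I‖}) :=
            (particleLaw_preimage_flow_zero _ _ _).symm
    · -- the limit `∫ χ uₗ ρ₀`: velocity fluctuation + density field with weight `χ uₗ`
      obtain ⟨Θ, -, hΘ⟩ := exists_forall_abs_le_of_continuous hθ
      have hA := tendsto_particleLaw_velFluct ha hθ hu ha0' hθ0 n ε hn Φ hP
        (Y := fun x v => v l - u x l) (by fun_prop)
        (fun x => (memLp_coord_gaussMeasure (u x) (θ x) l 2 (by simp)).sub (memLp_const _))
        (fun x => by
          rw [integral_sub ((memLp_coord_gaussMeasure (u x) (θ x) l 2 (by simp)).integrable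
            one_le_two) (integrable_const _), integral_coord_gaussMeasure _ (hθ0 x),
            integral_const]
          simp)
        (B := Θ) (fun x => by
          rw [variance_sub_const (X := fun v : V3 => v l)
            (by fun_prop : Continuous fun v : V3 => v l).aestronglyMeasurable,
            variance_coord_gaussMeasure _ (hθ0 x).le]
          exact (le_abs_self _).trans (hΘ x))
        hχ (η := δ / 2) (by positivity)
      have hB := hdens (fun y => χ y * u y l) (hχ.mul (by fun_prop)) (δ / 2) (by positivity)
      refine (tendsto_measure_lt_abs_add hA hB).congr fun N => ?_
      congr 1
      ext w
      simp only [Set.mem_setOf_eq]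
      rw [empiricalMomentumField_apply_sub w χ u l _, show (2 : ℝ) * (δ / 2) = δ by ring]
  /- (3) energy: for every continuous `χ`, `∫ χ E(ρ₀, U₀, Θ₀) = ∫ χ (|u|²/2 + 3θ/2) ρ₀` -/
  have hen : ∀ χ : T3 → ℝ, Continuous χ →
      ∫ x, χ x * totalEnergyDensity (ρ₀ x) (U₀ x) (Θ₀ x) =
        ∫ x, χ x * (‖u x‖ ^ 2 / 2 + Fintype.card (Fin 3) * θ x / 2) * ρ₀ x := by
    intro χ hχ
    refine eq_of_tendsto_measure_lt_abs_sub
      (fun N => particleLaw (Φ N) (canonicalDensity G3 (ε N) (n N) (localGibbsProfile a u θ)))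
      (fun N z => empiricalEnergyField z χ) (fun δ hδ => ?_) (fun δ hδ => ?_)
    · -- the limit `∫ χ E(ρ₀, U₀, Θ₀)` from the energy law of large numbers
      refine ((hL χ hχ δ hδ).2.2).congr fun N => ?_
      exact particleLaw_preimage_flow_zero (Φ N) _
        {w | δ < |empiricalEnergyField w χ - ∫ x, χ x * totalEnergyDensity (ρ₀ x) (U₀ x) (Θ₀ x)|}
    · -- the limit `∫ χ (|u|²/2 + 3θ/2) ρ₀`: kinetic-energy fluctuation + density field
      obtain ⟨Θ, hΘ0, hΘ⟩ := exists_forall_abs_le_of_continuous hθ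
      obtain ⟨U, hU0, hU⟩ := exists_forall_abs_le_of_continuous (continuous_norm.comp hu)
      have hmem : ∀ x, MemLp (fun v : V3 => ‖v‖ ^ 2 / 2 - ‖u x‖ ^ 2 / 2 -
          Fintype.card (Fin 3) * θ x / 2) 2 (gaussMeasure (u x) (θ x)) := fun x => by
        rw [show (fun v : V3 => ‖v‖ ^ 2 / 2 - ‖u x‖ ^ 2 / 2 - Fintype.card (Fin 3) * θ x / 2) =
            fun v => ‖v‖ ^ 2 / 2 - (‖u x‖ ^ 2 / 2 + Fintype.card (Fin 3) * θ x / 2) from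
          funext fun v => by ring]
        exact memLp_energy_gaussMeasure _ _ _
      have hA := tendsto_particleLaw_velFluct ha hθ hu ha0' hθ0 n ε hn Φ hP
        (Y := fun x v => ‖v‖ ^ 2 / 2 - ‖u x‖ ^ 2 / 2 - Fintype.card (Fin 3) * θ x / 2)
        (by fun_prop) hmem (fun x => integral_energy_gaussMeasure (u x) (hθ0 x))
        (B := 2 * 3 * Θ * U ^ 2 + Θ ^ 2 / 2 * gaussFourthMomentConst (Fin 3)) (fun x => by
          rw [variance_eq_sub (hmem x), integral_energy_gaussMeasure (u x) (hθ0 x)]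
          simp only [ne_eq, OfNat.ofNat_ne_zero, not_false_eq_true, zero_pow, sub_zero,
            Pi.pow_apply]
          have hθΘ : θ x ≤ Θ := (le_abs_self _).trans (hΘ x)
          have h1 : θ x * ‖u x‖ ^ 2 ≤ Θ * U ^ 2 :=
            mul_le_mul hθΘ (pow_le_pow_left₀ (norm_nonneg _) ((le_abs_self _).trans (hU x)) 2)
              (sq_nonneg _) hΘ0
          have h2 : θ x ^ 2 * gaussFourthMomentConst (Fin 3) ≤
              Θ ^ 2 * gaussFourthMomentConst (Fin 3) :=
            mul_le_mul_of_nonneg_right (pow_le_pow_left₀ (hθ0 x).le hθΘ 2)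
              gaussFourthMomentConst_nonneg
          have h3 := integral_energy_sq_gaussMeasure_le (u x) (hθ0 x)
          simp only [Fintype.card_fin, Nat.cast_ofNat] at h3 ⊢
          linarith)
        hχ (η := δ / 2) (by positivity)
      have hB := hdens (fun y => χ y * (‖u y‖ ^ 2 / 2 + Fintype.card (Fin 3) * θ y / 2))
        (by fun_prop) (δ / 2) (by positivity)
      refine (tendsto_measure_lt_abs_add hA hB).congr fun N => ?_
      congr 1
      ext w
      simp only [Set.mem_setOf_eq]
      rw [empiricalEnergyField_sub w χ u θ _, show (2 : ℝ) * (δ / 2) = δ by ring]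
  /- (4) pointwise identification -/
  intro x
  have hU : ∀ y, U₀ y = u y := fun y => PiLp.ext fun l => by
    have h := eq_of_forall_integral_mul_eq (f₁ := fun y => ρ₀ y * U₀ y l)
      (f₂ := fun y => u y l * ρ₀ y) (by fun_prop) (by fun_prop)
      (fun χ hχ => by simpa only [mul_assoc] using hmom χ hχ l) y
    have h' : ρ₀ y * (U₀ y l - u y l) = 0 := by linear_combination h
    rcases mul_eq_zero.1 h' with h | h
    · exact absurd h (hρ0 y).ne'
    · exact sub_eq_zero.1 h
  refine ⟨hU x, ?_⟩
  have h := eq_of_forall_integral_mul_eq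
    (f₁ := fun y => totalEnergyDensity (ρ₀ y) (U₀ y) (Θ₀ y))
    (f₂ := fun y => (‖u y‖ ^ 2 / 2 + Fintype.card (Fin 3) * θ y / 2) * ρ₀ y)
    (by unfold totalEnergyDensity; fun_prop) (by fun_prop)
    (fun χ hχ => by simpa only [mul_assoc] using hen χ hχ) x
  simp only [totalEnergyDensity, hU x, Fintype.card_fin, Nat.cast_ofNat] at h
  have h' : (3 / 2 * ρ₀ x) * (Θ₀ x - θ x) = 0 := by linear_combination h
  rcases mul_eq_zero.1 h' with h | h
  · exact absurd h (mul_pos (by norm_num) (hρ0 x)).ne'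
  · exact sub_eq_zero.1 h

end

end Summit.AtomisticToContinuum.HydrodynamicLimit.Theorems.LightConeInLawSketch.ProfileId
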